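import Literature.Analysis.InverseSpectral.StieltjesDataUnique
import Literature.Analysis.InverseSpectral.StieltjesRepresentation
import HarnessLib

/-!
# Stieltjes inversion: the measure `σ` is determined by `q`

For Stieltjes data `(b, σ)` of a function `q(z) = b + ∫_{[0,∞)} dσ(λ)/(λ - z)` (`KreinString.lean`,
`HasStieltjesRepresentation`) the measure is recovered from the boundary behaviour of `Im q`:
for every continuous compactly supported `g`,

  `∫ g(x) Im q(x + iy) dx = ∫ (g * P_y)(λ) dσ(λ) → π ∫ g dσ`  (`y ↓ 0`),

where `P_y(u) = y/(u² + y²)` is the Poisson kernel (`tendsto_integral_mul_im`), whence two Stieltjes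
representations of the same function have the same measure (`stieltjes_measure_unique`) — the
Stieltjes–Perron inversion formula in weak form (Kac–Kreĭn 1974, Supplement I, §S1.2–S1.4).

## References

KacKrein1974 (Supplement I §§S1.2–S1.5).
-/

open MeasureTheory Filter Set Topology
open scoped ENNReal Convolution

noncomputable section

namespace Literature.Analysis.InverseSpectral

/-! ### The Poisson kernel on the line -/

/-- The total mass of the Poisson kernel: `∫ y/((t-x)² + y²) dx = π` (`y > 0`). [folklore] -/
theorem integral_poissonKernel {y : ℝ} (hy : 0 < y) (t : ℝ) :
    ∫ x : ℝ, y / ((t - x) ^ 2 + y ^ 2) = Real.pi := by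
  have h1 : (fun x : ℝ => y / ((t - x) ^ 2 + y ^ 2)) = fun x => (fun u : ℝ => y⁻¹ * (1 + u ^ 2)⁻¹)
      (y⁻¹ * (x - t)) := by
    funext x
    have hy0 : y ≠ 0 := hy.ne'
    field_simp
    ring
  rw [h1, integral_sub_right_eq_self (fun x => (fun u : ℝ => y⁻¹ * (1 + u ^ 2)⁻¹) (y⁻¹ * x)) t,
    Measure.integral_comp_mul_left (fun u : ℝ => y⁻¹ * (1 + u ^ 2)⁻¹) y⁻¹, inv_inv, abs_of_pos hy,
    integral_const_mul, integral_univ_inv_one_add_sq, smul_eq_mul]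
  field_simp

/-- The Poisson kernel is non-negative. [folklore] -/
lemma poissonKernel_nonneg {y : ℝ} (hy : 0 ≤ y) (t x : ℝ) : 0 ≤ y / ((t - x) ^ 2 + y ^ 2) := by
  positivity

/-- Integrability of the Poisson kernel in `x`. [folklore] -/
lemma integrable_poissonKernel {y : ℝ} (hy : 0 < y) (t : ℝ) :
    Integrable (fun x : ℝ => y / ((t - x) ^ 2 + y ^ 2)) :=
  Integrable.of_integral_ne_zero (by rw [integral_poissonKernel hy t]; exact Real.pi_pos.ne')

/-- Integrability of `y/u²` on `(δ, ∞)` and its integral `y/δ`. [folklore] -/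
lemma integral_Ioi_div_sq {δ : ℝ} (hδ : 0 < δ) (y : ℝ) :
    IntegrableOn (fun u : ℝ => y / u ^ 2) (Ioi δ) ∧ ∫ u in Ioi δ, y / u ^ 2 = y / δ := by
  have hcongr : EqOn (fun u : ℝ => y * u ^ (-2 : ℝ)) (fun u : ℝ => y / u ^ 2) (Ioi δ) := by
    intro u hu
    simp only [mem_Ioi] at hu
    simp only
    rw [Real.rpow_neg (hδ.le.trans hu.le), Real.rpow_two, div_eq_mul_inv]
  have hint : IntegrableOn (fun u : ℝ => y / u ^ 2) (Ioi δ) :=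
    IntegrableOn.congr_fun
      ((integrableOn_Ioi_rpow_of_lt (by norm_num : (-2 : ℝ) < -1) hδ).const_mul y)
      hcongr measurableSet_Ioi
  refine ⟨hint, ?_⟩
  rw [← setIntegral_congr_fun measurableSet_Ioi hcongr, integral_const_mul,
    integral_Ioi_rpow_of_lt (by norm_num : (-2 : ℝ) < -1) hδ]
  have : (-2 : ℝ) + 1 = -1 := by norm_num
  rw [this, Real.rpow_neg_one]
  field_simp

/-- Tail of the comparison kernel: `∫_{|u| ≥ δ} y/u² du = 2y/δ`, with integrability. [folklore] -/
lemma integral_tail_div_sq {δ : ℝ} (hδ : 0 < δ) (y : ℝ) :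
    IntegrableOn (fun u : ℝ => y / u ^ 2) {u : ℝ | δ ≤ |u|} ∧
      ∫ u in {u : ℝ | δ ≤ |u|}, y / u ^ 2 = 2 * y / δ := by
  obtain ⟨hint, hIoi⟩ := integral_Ioi_div_sq hδ y
  have hset : {u : ℝ | δ ≤ |u|} = Iic (-δ) ∪ Ici δ := by
    ext u
    simp only [mem_setOf_eq, mem_union, mem_Iic, mem_Ici, le_abs, le_neg]
    tauto
  have hdisj : Disjoint (Iic (-δ)) (Ici δ) := by
    rw [Set.disjoint_left]
    intro u hu hu'
    simp only [mem_Iic, mem_Ici] at hu hu'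
    linarith
  have hint' : IntegrableOn (fun u : ℝ => y / u ^ 2) (Ici δ) :=
    hint.congr_set_ae Ioi_ae_eq_Ici.symm
  -- the left tail by the symmetry `u ↦ -u`
  have hneg := Measure.measurePreserving_neg (volume : Measure ℝ)
  have hemb : MeasurableEmbedding (fun u : ℝ => -u) := (Homeomorph.neg ℝ).measurableEmbedding
  have hpre : (fun u : ℝ => -u) ⁻¹' Iic (-δ) = Ici δ := by
    ext u; simp
  have hint'' : IntegrableOn (fun u : ℝ => y / u ^ 2) (Iic (-δ)) := by
    rw [← hneg.integrableOn_comp_preimage hemb, hpre]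
    refine hint'.congr_fun (fun u _ => ?_) measurableSet_Ici
    simp
  have hIic : ∫ u in Iic (-δ), y / u ^ 2 = y / δ := by
    rw [← integral_comp_neg_Ioi]
    simp only [even_two, Even.neg_pow]
    exact hIoi
  refine ⟨by rw [hset]; exact hint''.union hint', ?_⟩
  rw [hset, setIntegral_union hdisj measurableSet_Ici hint'' hint', integral_Ici_eq_integral_Ioi,
    hIic, hIoi]
  ring

/-- The shifted tail: `∫_{|x-t| ≥ δ} y/(t-x)² dx = 2y/δ`, with integrability. [folklore] -/
lemma integral_tail_div_sq_shift {δ : ℝ} (hδ : 0 < δ) (y t : ℝ) :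
    IntegrableOn (fun x : ℝ => y / (t - x) ^ 2) {x : ℝ | δ ≤ |x - t|} ∧
      ∫ x in {x : ℝ | δ ≤ |x - t|}, y / (t - x) ^ 2 = 2 * y / δ := by
  obtain ⟨hint, hval⟩ := integral_tail_div_sq hδ y
  have hemb := measurableEmbedding_addRight t
  have hmap : Measure.map (fun u : ℝ => u + t) volume = volume := map_add_right_eq_self _ t
  have hpre : (fun u : ℝ => u + t) ⁻¹' {x : ℝ | δ ≤ |x - t|} = {u : ℝ | δ ≤ |u|} := by
    ext u; simp
  have hfun : ∀ u : ℝ, y / (t - (u + t)) ^ 2 = y / u ^ 2 := fun u => by ring_nf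
  constructor
  · rw [← hmap, hemb.integrableOn_map_iff, hpre]
    exact hint.congr_fun (fun u _ => (hfun u).symm) (by
      exact measurableSet_le measurable_const (continuous_abs.measurable))
  · rw [← hmap, hemb.setIntegral_map, hpre]
    simp_rw [hfun]
    exact hval

/-- **The Poisson kernel is an approximate identity**: for `g` continuous with compact support,
`∫ y/((t-x)²+y²) g(x) dx → π g(t)` as `y ↓ 0`. [folklore] -/
theorem tendsto_poisson_integral {g : ℝ → ℝ} (hg : Continuous g) (hgs : HasCompactSupport g)
    (t : ℝ) :
    Tendsto (fun y : ℝ => ∫ x, y / ((t - x) ^ 2 + y ^ 2) * g x) (𝓝[>] 0)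
      (𝓝 (Real.pi * g t)) := by
  obtain ⟨M, hM⟩ := hgs.exists_bound_of_continuous hg
  have hM0 : 0 ≤ M := (norm_nonneg _).trans (hM 0)
  have hpi := Real.pi_pos
  rw [Metric.tendsto_nhdsWithin_nhds]
  intro ε hε
  obtain ⟨δ, hδ, hδg⟩ := Metric.uniformContinuous_iff.1 (hgs.uniformContinuous_of_continuous hg)
    (ε / (2 * Real.pi)) (by positivity)
  refine ⟨ε * δ / (8 * (M + 1)), by positivity, fun {y} hy hyd => ?_⟩
  have hy0 : 0 < y := hy
  rw [Real.dist_eq, sub_zero, abs_of_pos hy0] at hyd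
  -- the kernel and the error integrand
  set P : ℝ → ℝ := fun x => y / ((t - x) ^ 2 + y ^ 2) with hP
  have hPint : Integrable P := integrable_poissonKernel hy0 t
  have hPpos : ∀ x, 0 ≤ P x := fun x => poissonKernel_nonneg hy0.le t x
  have hPc : Continuous P := by
    refine continuous_const.div (by fun_prop) (fun x => ?_)
    positivity
  have hEint : Integrable (fun x => P x * (g x - g t)) := by
    refine (hPint.mul_const (2 * M)).mono' (hPc.mul (hg.sub continuous_const)).aestronglyMeasurable
      (ae_of_all _ fun x => ?_)
    rw [norm_mul, Real.norm_eq_abs, abs_of_nonneg (hPpos x)]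
    refine mul_le_mul_of_nonneg_left ?_ (hPpos x)
    calc ‖g x - g t‖ ≤ ‖g x‖ + ‖g t‖ := norm_sub_le _ _
      _ ≤ M + M := add_le_add (hM x) (hM t)
      _ = 2 * M := by ring
  -- `∫ P g - π g(t) = ∫ P (g - g t)`
  have hdiff : (∫ x, P x * g x) - Real.pi * g t = ∫ x, P x * (g x - g t) := by
    have h1 : ∫ x, P x * (g x - g t) = (∫ x, P x * g x) - ∫ x, P x * g t := by
      rw [← integral_sub]
      · exact integral_congr_ae (ae_of_all _ fun x => by ring)
      · exact (hPint.mul_const M).mono' (hPc.mul hg).aestronglyMeasurable (ae_of_all _ fun x => by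
          rw [norm_mul, Real.norm_eq_abs, abs_of_nonneg (hPpos x)]
          exact mul_le_mul_of_nonneg_left (hM x) (hPpos x))
      · exact hPint.mul_const _
    rw [h1, integral_mul_const, integral_poissonKernel hy0 t]
  -- near part
  have hnear : ‖∫ x in Metric.ball t δ, P x * (g x - g t)‖ ≤ ε / 2 := by
    calc ‖∫ x in Metric.ball t δ, P x * (g x - g t)‖
        ≤ ∫ x in Metric.ball t δ, ‖P x * (g x - g t)‖ := norm_integral_le_integral_norm _
      _ ≤ ∫ x in Metric.ball t δ, P x * (ε / (2 * Real.pi)) := by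
          refine setIntegral_mono_on hEint.norm.integrableOn (hPint.mul_const _).integrableOn
            measurableSet_ball (fun x hx => ?_)
          rw [norm_mul, Real.norm_eq_abs, abs_of_nonneg (hPpos x)]
          refine mul_le_mul_of_nonneg_left (le_of_lt ?_) (hPpos x)
          have h := hδg (Metric.mem_ball.1 hx)
          rwa [Real.dist_eq, Real.norm_eq_abs] at *
      _ ≤ ∫ x, P x * (ε / (2 * Real.pi)) :=
          setIntegral_le_integral (hPint.mul_const _) (ae_of_all _ fun x => by
            have := hPpos x; positivity)
      _ = ε / 2 := by
          rw [integral_mul_const, integral_poissonKernel hy0 t]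
          field_simp
  -- far part
  have hcompl : (Metric.ball t δ)ᶜ = {x : ℝ | δ ≤ |x - t|} := by
    ext x
    simp [Metric.mem_ball, Real.dist_eq, not_lt]
  obtain ⟨htint, htval⟩ := integral_tail_div_sq_shift hδ y t
  have hfar : ‖∫ x in (Metric.ball t δ)ᶜ, P x * (g x - g t)‖ ≤ 2 * M * (2 * y / δ) := by
    rw [hcompl]
    calc ‖∫ x in {x : ℝ | δ ≤ |x - t|}, P x * (g x - g t)‖
        ≤ ∫ x in {x : ℝ | δ ≤ |x - t|}, ‖P x * (g x - g t)‖ := norm_integral_le_integral_norm _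
      _ ≤ ∫ x in {x : ℝ | δ ≤ |x - t|}, (2 * M) * (y / (t - x) ^ 2) := by
          refine setIntegral_mono_on hEint.norm.integrableOn (htint.const_mul _)
            (measurableSet_le measurable_const
              (continuous_abs.comp (continuous_sub_right t)).measurable)
            (fun x hx => ?_)
          simp only [mem_setOf_eq] at hx
          have hx0 : 0 < (t - x) ^ 2 := by
            have : t - x ≠ 0 := by
              intro h; rw [show x = t by linarith, sub_self, abs_zero] at hx; linarith
            positivity
          rw [norm_mul, Real.norm_eq_abs, abs_of_nonneg (hPpos x), mul_comm]
          refine mul_le_mul ?_ ?_ (hPpos x) (by positivity)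
          · calc ‖g x - g t‖ ≤ ‖g x‖ + ‖g t‖ := norm_sub_le _ _
              _ ≤ M + M := add_le_add (hM x) (hM t)
              _ = 2 * M := by ring
          · exact div_le_div_of_nonneg_left hy0.le hx0 (by nlinarith)
      _ = 2 * M * (2 * y / δ) := by rw [integral_const_mul, htval]
  -- conclusion
  rw [Real.dist_eq, hdiff, ← integral_add_compl measurableSet_ball hEint, ← Real.norm_eq_abs]
  calc ‖(∫ x in Metric.ball t δ, P x * (g x - g t)) + ∫ x in (Metric.ball t δ)ᶜ, P x * (g x - g t)‖
      ≤ ‖∫ x in Metric.ball t δ, P x * (g x - g t)‖ +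
          ‖∫ x in (Metric.ball t δ)ᶜ, P x * (g x - g t)‖ := norm_add_le _ _
    _ ≤ ε / 2 + 2 * M * (2 * y / δ) := add_le_add hnear hfar
    _ < ε := by
        have h1 : 2 * M * (2 * y / δ) ≤ 4 * (M + 1) * y / δ := by
          rw [show 2 * M * (2 * y / δ) = 4 * M * y / δ by ring]
          gcongr
          linarith
        have h2 : 4 * (M + 1) * y / δ < ε / 2 := by
          rw [div_lt_iff₀ hδ]
          have := mul_lt_mul_of_pos_left hyd (by positivity : (0 : ℝ) < 4 * (M + 1))
          calc 4 * (M + 1) * y < 4 * (M + 1) * (ε * δ / (8 * (M + 1))) := this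
            _ = ε / 2 * δ := by field_simp; ring
        linarith

/-! ### Decay of the smoothed test function -/

/-- **Uniform decay of `(P_y g)`**: for `g` continuous with compact support there is `K` with
`|∫ y/((t-x)²+y²) g(x) dx| ≤ K (1+t)⁻¹` for all `t ≥ 0` and `0 < y ≤ 1`. [folklore] -/
theorem exists_bound_poisson_integral {g : ℝ → ℝ} (hg : Continuous g) (hgs : HasCompactSupport g) :
    ∃ K : ℝ, 0 ≤ K ∧ ∀ t : ℝ, 0 ≤ t → ∀ y : ℝ, 0 < y → y ≤ 1 →
      |∫ x, y / ((t - x) ^ 2 + y ^ 2) * g x| ≤ K * (1 + t)⁻¹ := by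
  obtain ⟨M, hM⟩ := hgs.exists_bound_of_continuous hg
  have hM0 : 0 ≤ M := (norm_nonneg _).trans (hM 0)
  obtain ⟨R₀, hR₀⟩ := (hgs.isCompact.isBounded).subset_closedBall (0 : ℝ)
  set R := max R₀ 0 with hR
  have hR0 : 0 ≤ R := le_max_right _ _
  have hsupp : ∀ x : ℝ, R < |x| → g x = 0 := by
    intro x hx
    have hx' : x ∉ tsupport g := fun h => by
      have := hR₀ h
      rw [Metric.mem_closedBall, dist_zero_right, Real.norm_eq_abs] at this
      linarith [le_max_left R₀ 0]
    exact image_eq_zero_of_notMem_tsupport hx'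
  refine ⟨M * (R + 2) * (Real.pi + 2 * R), by positivity, fun t ht y hy0 hy1 => ?_⟩
  have hP : ∀ x, 0 ≤ y / ((t - x) ^ 2 + y ^ 2) := fun x => poissonKernel_nonneg hy0.le t x
  have hPint := integrable_poissonKernel hy0 t
  have hPgint : Integrable (fun x => y / ((t - x) ^ 2 + y ^ 2) * g x) := by
    refine (hPint.mul_const M).mono' ?_ (ae_of_all _ fun x => ?_)
    · exact ((continuous_const.div (by fun_prop) (fun x => by positivity)).mul
        hg).aestronglyMeasurable
    · rw [norm_mul, Real.norm_eq_abs, abs_of_nonneg (hP x)]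
      exact mul_le_mul_of_nonneg_left (hM x) (hP x)
  rcases le_or_gt t (R + 1) with htR | htR
  · -- `t ≤ R + 1`: the trivial bound `M π`
    have h1 : |∫ x, y / ((t - x) ^ 2 + y ^ 2) * g x| ≤ M * Real.pi := by
      rw [← Real.norm_eq_abs]
      calc ‖∫ x, y / ((t - x) ^ 2 + y ^ 2) * g x‖ ≤ ∫ x, ‖y / ((t - x) ^ 2 + y ^ 2) * g x‖ :=
            norm_integral_le_integral_norm _
        _ ≤ ∫ x, y / ((t - x) ^ 2 + y ^ 2) * M := by
            refine integral_mono hPgint.norm (hPint.mul_const M) (fun x => ?_)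
            simp only
            rw [norm_mul, Real.norm_eq_abs, abs_of_nonneg (hP x)]
            exact mul_le_mul_of_nonneg_left (hM x) (hP x)
        _ = M * Real.pi := by rw [integral_mul_const, integral_poissonKernel hy0 t, mul_comm]
    calc |∫ x, y / ((t - x) ^ 2 + y ^ 2) * g x| ≤ M * Real.pi := h1
      _ = M * Real.pi * (1 + t) * (1 + t)⁻¹ := by field_simp
      _ ≤ M * (R + 2) * (Real.pi + 2 * R) * (1 + t)⁻¹ := by
          have h2 : 0 ≤ (1 + t)⁻¹ := by positivity
          have h3 : M * Real.pi * (1 + t) ≤ M * (R + 2) * (Real.pi + 2 * R) := by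
            have : Real.pi * (1 + t) ≤ (R + 2) * (Real.pi + 2 * R) := by
              nlinarith [Real.pi_pos, mul_nonneg hR0 Real.pi_pos.le]
            nlinarith
          exact mul_le_mul_of_nonneg_right h3 h2
  · -- `t > R + 1`: the support of `g` is far from `t`
    have h1 : |∫ x, y / ((t - x) ^ 2 + y ^ 2) * g x| ≤ 2 * R * M * (y / (t - R) ^ 2) := by
      rw [← setIntegral_eq_integral_of_forall_compl_eq_zero (s := Icc (-R) R) (fun x hx => by
        rw [hsupp x (by simp only [mem_Icc, not_and_or, not_le] at hx; rcases hx with h | h <;>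
          [rw [abs_of_neg (by linarith)]; rw [abs_of_pos (by linarith)]] <;> linarith), mul_zero])]
      rw [← Real.norm_eq_abs]
      have hvol : volume (Icc (-R) R) < ⊤ := measure_Icc_lt_top
      calc ‖∫ x in Icc (-R) R, y / ((t - x) ^ 2 + y ^ 2) * g x‖
          ≤ M * (y / (t - R) ^ 2) * (volume.real (Icc (-R) R)) := by
            refine norm_setIntegral_le_of_norm_le_const hvol (fun x hx => ?_)
            rw [norm_mul, Real.norm_eq_abs, abs_of_nonneg (hP x), mul_comm]
            refine mul_le_mul (hM x) ?_ (hP x) hM0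
            have htx : t - R ≤ t - x := by linarith [hx.2]
            have h0 : 0 < t - R := by linarith
            exact div_le_div_of_nonneg_left hy0.le (by positivity) (by nlinarith)
        _ = 2 * R * M * (y / (t - R) ^ 2) := by
            rw [Real.volume_real_Icc_of_le (by linarith)]
            ring
    have h2 : y / (t - R) ^ 2 ≤ (R + 2) * (1 + t)⁻¹ := by
      have h0 : 1 ≤ t - R := by linarith
      calc y / (t - R) ^ 2 ≤ 1 / (t - R) := by
            rw [div_le_div_iff₀ (by positivity) (by positivity)]
            nlinarith
        _ ≤ (R + 2) / (1 + t) := by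
            rw [div_le_div_iff₀ (by positivity) (by positivity)]
            nlinarith
        _ = (R + 2) * (1 + t)⁻¹ := div_eq_mul_inv _ _
    calc |∫ x, y / ((t - x) ^ 2 + y ^ 2) * g x| ≤ 2 * R * M * (y / (t - R) ^ 2) := h1
      _ ≤ 2 * R * M * ((R + 2) * (1 + t)⁻¹) := by gcongr
      _ ≤ M * (R + 2) * (Real.pi + 2 * R) * (1 + t)⁻¹ := by
          have h3 : 0 ≤ (1 + t)⁻¹ := by positivity
          have h4 : 2 * R * M * (R + 2) ≤ M * (R + 2) * (Real.pi + 2 * R) := by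
            nlinarith [Real.pi_pos, mul_nonneg hM0 hR0,
              mul_nonneg (mul_nonneg hM0 hR0) Real.pi_pos.le, mul_nonneg hM0 Real.pi_pos.le]
          nlinarith

/-! ### Stieltjes inversion -/

section Inversion

variable {q : ℂ → ℂ} {b : ℝ} {σ : Measure ℝ}

/-- `σ`-a.e. `t ≥ 0` for Stieltjes data. [folklore] -/
lemma ae_nonneg_of_hasStieltjesRepresentation (h : HasStieltjesRepresentation q b σ) :
    ∀ᵐ t ∂σ, (0 : ℝ) ≤ t := by
  rw [ae_iff]
  have hset : {a : ℝ | ¬0 ≤ a} = Iio 0 := by ext a; simp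
  rw [hset]
  exact h.2.1

/-- Integrability of the Cauchy kernel against Stieltjes data off `[0, ∞)`. [folklore] -/
lemma integrable_inv_sub_stieltjes (h : HasStieltjesRepresentation q b σ) {z : ℂ}
    (hz : z ∈ offNonnegAxis) : Integrable (fun t : ℝ => ((t : ℂ) - z)⁻¹) σ := by
  obtain ⟨D, hD0, hD⟩ := exists_norm_inv_sub_le hz
  refine Integrable.mono' ((integrable_inv_one_add_of_hasStieltjesRepresentation h).const_mul D)
    ((Complex.measurable_ofReal.sub_const z).inv.aestronglyMeasurable) ?_
  filter_upwards [ae_nonneg_of_hasStieltjesRepresentation h] with t ht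
  exact hD t ht

/-- **`Im q` is the Poisson integral of `σ`**: `Im q(x + iy) = ∫ y/((t-x)² + y²) dσ(t)` (`y > 0`).
[cite: KacKrein1974, Supplement I §S1.2] -/
theorem im_apply_eq_poisson_integral (h : HasStieltjesRepresentation q b σ) (x : ℝ) {y : ℝ}
    (hy : 0 < y) :
    (q ((x : ℂ) + y * Complex.I)).im = ∫ t, y / ((t - x) ^ 2 + y ^ 2) ∂σ := by
  have hz : ((x : ℂ) + y * Complex.I) ∈ offNonnegAxis := Or.inl (by simpa using hy.ne')
  rw [h.2.2.2 _ hz, Complex.add_im, Complex.ofReal_im, zero_add, ← RCLike.im_to_complex,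
    ← integral_im (integrable_inv_sub_stieltjes h hz)]
  refine integral_congr_ae (ae_of_all _ fun t => ?_)
  dsimp only
  rw [RCLike.im_to_complex, Complex.inv_im, Complex.normSq_apply]
  simp
  ring

/-- Joint continuity of the integrand `(x, t) ↦ g(x) · y/((t-x)² + y²)`. [folklore] -/
lemma continuous_poisson_integrand {g : ℝ → ℝ} (hg : Continuous g) {y : ℝ} (hy : 0 < y) :
    Continuous (fun p : ℝ × ℝ => g p.1 * (y / ((p.2 - p.1) ^ 2 + y ^ 2))) := by
  refine (hg.comp continuous_fst).mul (continuous_const.div (by fun_prop) (fun p => ?_))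
  positivity

/-- Stieltjes data are locally finite measures. [folklore] -/
lemma isLocallyFiniteMeasure_of_hasStieltjesRepresentation (h : HasStieltjesRepresentation q b σ) :
    IsLocallyFiniteMeasure σ := by
  have hw := integrable_inv_one_add_of_hasStieltjesRepresentation h
  refine ⟨fun x => ⟨Ioo (x - 1) (x + 1), Ioo_mem_nhds (by linarith) (by linarith), ?_⟩⟩
  have hsub : Ioo (x - 1) (x + 1) ⊆ {t : ℝ | (2 + |x|)⁻¹ ≤ (1 + t)⁻¹} ∪ Iio 0 := by
    intro t ht
    rcases lt_or_ge t 0 with h0 | h0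
    · exact Or.inr h0
    · left
      show (2 + |x|)⁻¹ ≤ (1 + t)⁻¹
      refine inv_anti₀ (by positivity) ?_
      have : t < x + 1 := ht.2
      linarith [le_abs_self x]
  refine lt_of_le_of_lt (measure_mono hsub) ?_
  refine lt_of_le_of_lt (measure_union_le _ _) ?_
  rw [h.2.1, add_zero]
  exact hw.measure_ge_lt_top (by positivity)

/-- **Fubini**: `∫ g(x) Im q(x+iy) dx = ∫ (∫ y/((t-x)²+y²) g(x) dx) dσ(t)` for continuous compactly
supported `g` and `0 < y ≤ 1`. [cite: KacKrein1974, Supplement I §S1.4] -/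
theorem integral_mul_im_apply_eq (h : HasStieltjesRepresentation q b σ) {g : ℝ → ℝ}
    (hg : Continuous g) (hgs : HasCompactSupport g) {y : ℝ} (hy : 0 < y) (hy1 : y ≤ 1) :
    ∫ x, g x * (q ((x : ℂ) + y * Complex.I)).im =
      ∫ t, (∫ x, y / ((t - x) ^ 2 + y ^ 2) * g x) ∂σ := by
  haveI := isLocallyFiniteMeasure_of_hasStieltjesRepresentation h
  -- the integrand on the product
  set F : ℝ → ℝ → ℝ := fun x t => g x * (y / ((t - x) ^ 2 + y ^ 2)) with hF
  have hFc : Continuous (Function.uncurry F) := continuous_poisson_integrand hg hy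
  -- integrability on `volume × σ`
  obtain ⟨K, hK0, hK⟩ := exists_bound_poisson_integral (continuous_norm.comp hg) hgs.norm
  have hae := ae_nonneg_of_hasStieltjesRepresentation h
  have hw := integrable_inv_one_add_of_hasStieltjesRepresentation h
  obtain ⟨M, hM⟩ := hgs.exists_bound_of_continuous hg
  have hFint : Integrable (Function.uncurry F) ((volume : Measure ℝ).prod σ) := by
    rw [integrable_prod_iff' hFc.aestronglyMeasurable]
    constructor
    · refine ae_of_all _ (fun t => ?_)
      have hPint := integrable_poissonKernel hy t
      refine (hPint.mul_const M).mono' ?_ (ae_of_all _ fun x => ?_)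
      · exact (hFc.comp (Continuous.prodMk_left t)).aestronglyMeasurable
      · simp only [Function.uncurry_apply_pair, hF]
        rw [norm_mul, Real.norm_of_nonneg (poissonKernel_nonneg hy.le t x), mul_comm]
        exact mul_le_mul_of_nonneg_left (hM x) (poissonKernel_nonneg hy.le t x)
    · have hmeas : AEStronglyMeasurable (fun t => ∫ x, ‖Function.uncurry F (x, t)‖) σ := by
        have h1 : AEStronglyMeasurable (fun p : ℝ × ℝ => ‖Function.uncurry F (p.2, p.1)‖)
            (σ.prod volume) :=
          (hFc.comp (continuous_snd.prodMk continuous_fst)).norm.aestronglyMeasurable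
        exact h1.integral_prod_right'
      refine Integrable.mono' (hw.const_mul K) hmeas ?_
      filter_upwards [hae] with t ht
      rw [Real.norm_eq_abs, abs_of_nonneg (integral_nonneg fun x => norm_nonneg _)]
      have hk := hK t ht y hy hy1
      have heq : ∫ x, ‖Function.uncurry F (x, t)‖ = ∫ x, y / ((t - x) ^ 2 + y ^ 2) * ‖g x‖ := by
        refine integral_congr_ae (ae_of_all _ fun x => ?_)
        simp only [Function.uncurry_apply_pair, hF]
        rw [norm_mul, Real.norm_of_nonneg (poissonKernel_nonneg hy.le t x), mul_comm]
      rw [heq]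
      exact (le_abs_self _).trans hk
  -- Fubini
  calc ∫ x, g x * (q ((x : ℂ) + y * Complex.I)).im
      = ∫ x, ∫ t, F x t ∂σ := by
        refine integral_congr_ae (ae_of_all _ fun x => ?_)
        simp only [hF]
        rw [im_apply_eq_poisson_integral h x hy, integral_const_mul]
    _ = ∫ t, ∫ x, F x t ∂volume ∂σ := integral_integral_swap hFint
    _ = ∫ t, (∫ x, y / ((t - x) ^ 2 + y ^ 2) * g x) ∂σ := by
        refine integral_congr_ae (ae_of_all _ fun t => integral_congr_ae (ae_of_all _ fun x => ?_))
        simp only [hF]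
        ring

/-- **Boundary limit**: `∫ g(x) Im q(x + iy) dx → π ∫ g dσ` as `y ↓ 0`, for continuous compactly
supported `g` (the Stieltjes–Perron inversion formula in weak form).
[cite: KacKrein1974, Supplement I §S1.4] -/
theorem tendsto_integral_mul_im (h : HasStieltjesRepresentation q b σ) {g : ℝ → ℝ}
    (hg : Continuous g) (hgs : HasCompactSupport g) :
    Tendsto (fun y : ℝ => ∫ x, g x * (q ((x : ℂ) + y * Complex.I)).im) (𝓝[>] 0)
      (𝓝 (Real.pi * ∫ t, g t ∂σ)) := by
  haveI := isLocallyFiniteMeasure_of_hasStieltjesRepresentation h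
  have hae := ae_nonneg_of_hasStieltjesRepresentation h
  have hw := integrable_inv_one_add_of_hasStieltjesRepresentation h
  obtain ⟨K, hK0, hK⟩ := exists_bound_poisson_integral hg hgs
  have hev : ∀ᶠ y in 𝓝[>] (0 : ℝ), y ∈ Ioc 0 1 := Ioc_mem_nhdsGT one_pos
  have heq : ∀ᶠ y in 𝓝[>] (0 : ℝ), ∫ t, (∫ x, y / ((t - x) ^ 2 + y ^ 2) * g x) ∂σ =
      ∫ x, g x * (q ((x : ℂ) + y * Complex.I)).im := by
    filter_upwards [hev] with y hy
    exact (integral_mul_im_apply_eq h hg hgs hy.1 hy.2).symm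
  refine Tendsto.congr' heq ?_
  rw [← integral_const_mul]
  refine tendsto_integral_filter_of_dominated_convergence (fun t => K * (1 + t)⁻¹) ?_ ?_
    (hw.const_mul K) ?_
  · filter_upwards [hev] with y hy
    have hFc := continuous_poisson_integrand hg hy.1
    have h1 : AEStronglyMeasurable
        (fun p : ℝ × ℝ =>
          Function.uncurry (fun x t => g x * (y / ((t - x) ^ 2 + y ^ 2))) (p.2, p.1))
        (σ.prod volume) :=
      (hFc.comp (continuous_snd.prodMk continuous_fst)).aestronglyMeasurable
    refine (h1.integral_prod_right').congr (ae_of_all _ fun t => ?_)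
    refine integral_congr_ae (ae_of_all _ fun x => ?_)
    simp only [Function.uncurry_apply_pair]
    ring
  · filter_upwards [hev] with y hy
    filter_upwards [hae] with t ht
    rw [Real.norm_eq_abs]
    exact hK t ht y hy.1 hy.2
  · filter_upwards [] with t
    exact tendsto_poisson_integral hg hgs t

/-- **Uniqueness of the Stieltjes measure** (Stieltjes–Perron inversion): two Stieltjes
representations of the same function have the same measure.
[cite: KacKrein1974, Supplement I §S1.4] -/
theorem stieltjes_measure_unique {q : ℂ → ℂ} {b₁ b₂ : ℝ} {σ₁ σ₂ : Measure ℝ}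
    (h₁ : HasStieltjesRepresentation q b₁ σ₁) (h₂ : HasStieltjesRepresentation q b₂ σ₂) :
    σ₁ = σ₂ := by
  haveI := isLocallyFiniteMeasure_of_hasStieltjesRepresentation h₁
  haveI := isLocallyFiniteMeasure_of_hasStieltjesRepresentation h₂
  haveI : σ₁.Regular := Measure.Regular.of_sigmaCompactSpace_of_isLocallyFiniteMeasure σ₁
  haveI : σ₂.Regular := Measure.Regular.of_sigmaCompactSpace_of_isLocallyFiniteMeasure σ₂
  refine Measure.ext_of_integral_eq_on_compactlySupported (fun f => ?_)
  have h := tendsto_nhds_unique (tendsto_integral_mul_im h₁ f.continuous f.hasCompactSupport)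
    (tendsto_integral_mul_im h₂ f.continuous f.hasCompactSupport)
  have hpi := Real.pi_pos
  have := mul_left_cancel₀ hpi.ne' h
  exact this

/-- **Stieltjes data are unique.** [cite: KacKrein1974, Supplement I §S1.4] -/
theorem stieltjes_data_unique {q : ℂ → ℂ} {b₁ b₂ : ℝ} {σ₁ σ₂ : Measure ℝ}
    (h₁ : HasStieltjesRepresentation q b₁ σ₁) (h₂ : HasStieltjesRepresentation q b₂ σ₂) :
    b₁ = b₂ ∧ σ₁ = σ₂ :=
  ⟨stieltjes_const_unique h₁ h₂, stieltjes_measure_unique h₁ h₂⟩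

/-- **The spectral data of a string are canonical**: any Stieltjes data of `q_S` coincide with
`(weylConstant S, spectralMeasure S)`. [cite: KacKrein1974, §2] -/
theorem KreinString.eq_spectralData (S : KreinString) {b : ℝ} {σ : Measure ℝ}
    (h : HasStieltjesRepresentation S.principalWeylFunction b σ) :
    b = S.weylConstant ∧ σ = S.spectralMeasure :=
  stieltjes_data_unique h (S.hasStieltjesRepresentation_spectralMeasure ⟨b, σ, h⟩)

/-! ### Locating the measure: atoms and intervals of regularity -/

/-- **Atom bound**: `σ{x} ≤ y · Im q(x + iy)` for Stieltjes data `(b, σ)` of `q` and `y > 0`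
(the Poisson kernel is `≥ 1/y` at `t = x`). [cite: KacKrein1974, Supplement I §S1.4] -/
theorem measureReal_singleton_le (h : HasStieltjesRepresentation q b σ) (x : ℝ) {y : ℝ}
    (hy : 0 < y) : (σ {x}).toReal ≤ y * (q ((x : ℂ) + y * Complex.I)).im := by
  haveI := isLocallyFiniteMeasure_of_hasStieltjesRepresentation h
  have hz : ((x : ℂ) + y * Complex.I) ∈ offNonnegAxis := Or.inl (by simpa using hy.ne')
  have hPint : Integrable (fun t : ℝ => y / ((t - x) ^ 2 + y ^ 2)) σ := by
    have h1 := (integrable_inv_sub_stieltjes h hz).im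
    refine h1.congr (ae_of_all _ fun t => ?_)
    simp only
    rw [RCLike.im_to_complex, Complex.inv_im, Complex.normSq_apply]
    simp
    ring
  rw [im_apply_eq_poisson_integral h x hy]
  have hle : ∫ t in ({x} : Set ℝ), y / ((t - x) ^ 2 + y ^ 2) ∂σ ≤
      ∫ t, y / ((t - x) ^ 2 + y ^ 2) ∂σ :=
    setIntegral_le_integral hPint (ae_of_all _ fun t => poissonKernel_nonneg hy.le t x)
  have hfx : y / ((x - x) ^ 2 + y ^ 2) = y⁻¹ := by
    rw [sub_self]
    field_simp
    ring
  rw [integral_singleton, smul_eq_mul, hfx, measureReal_def] at hle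
  calc (σ {x}).toReal = y * ((σ {x}).toReal * y⁻¹) := by field_simp
    _ ≤ y * ∫ t, y / ((t - x) ^ 2 + y ^ 2) ∂σ := mul_le_mul_of_nonneg_left hle hy.le

/-- A continuous trapezoid: `1` on `[a, b]`, `0` off `(a - η, b + η)`, values in `[0, 1]`.
[folklore] -/
lemma exists_trapezoid (a b : ℝ) {η : ℝ} (hη : 0 < η) :
    ∃ g : ℝ → ℝ, Continuous g ∧ HasCompactSupport g ∧ (∀ x, 0 ≤ g x ∧ g x ≤ 1) ∧
      (∀ x ∈ Icc a b, g x = 1) ∧ (∀ x, g x ≠ 0 → x ∈ Icc (a - η) (b + η)) := by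
  refine ⟨fun x => max 0 (min 1 (min ((x - (a - η)) / η) ((b + η - x) / η))), ?_, ?_, ?_, ?_, ?_⟩
  · fun_prop
  · refine HasCompactSupport.intro (K := Icc (a - η) (b + η)) isCompact_Icc (fun x hx => ?_)
    simp only [mem_Icc, not_and_or, not_le] at hx
    refine max_eq_left ?_
    rcases hx with hx | hx
    · refine (min_le_right _ _).trans ((min_le_left _ _).trans ?_)
      exact div_nonpos_of_nonpos_of_nonneg (by linarith) hη.le
    · refine (min_le_right _ _).trans ((min_le_right _ _).trans ?_)
      exact div_nonpos_of_nonpos_of_nonneg (by linarith) hη.le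
  · intro x
    exact ⟨le_max_left _ _, max_le zero_le_one (min_le_left _ _)⟩
  · intro x hx
    have h1 : 1 ≤ (x - (a - η)) / η := by rw [le_div_iff₀ hη]; linarith [hx.1]
    have h2 : 1 ≤ (b + η - x) / η := by rw [le_div_iff₀ hη]; linarith [hx.2]
    show max 0 (min 1 (min ((x - (a - η)) / η) ((b + η - x) / η))) = 1
    rw [min_eq_left (le_min h1 h2), max_eq_right zero_le_one]
  · intro x hx
    by_contra hx'
    simp only [mem_Icc, not_and_or, not_le] at hx'
    apply hx
    refine max_eq_left ?_
    rcases hx' with hx' | hx'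
    · refine (min_le_right _ _).trans ((min_le_left _ _).trans ?_)
      exact div_nonpos_of_nonpos_of_nonneg (by linarith) hη.le
    · refine (min_le_right _ _).trans ((min_le_right _ _).trans ?_)
      exact div_nonpos_of_nonpos_of_nonneg (by linarith) hη.le

/-- **Vanishing on intervals of regularity**: if `Im q(x + iy) → 0` uniformly for `x` in
`[A, B]` as `y ↓ 0`, then `σ((A, B)) = 0`. [cite: KacKrein1974, Supplement I §S1.4] -/
theorem measure_Ioo_eq_zero_of_im_tendsto_zero (h : HasStieltjesRepresentation q b σ) {A B : ℝ}
    (hunif : ∀ ε > 0, ∀ᶠ y : ℝ in 𝓝[>] 0,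
      ∀ x ∈ Icc A B, |(q ((x : ℂ) + (y : ℂ) * Complex.I)).im| ≤ ε) :
    σ (Ioo A B) = 0 := by
  haveI := isLocallyFiniteMeasure_of_hasStieltjesRepresentation h
  -- closed subintervals have measure zero
  have hIcc : ∀ a b' : ℝ, A < a → a ≤ b' → b' < B → σ (Icc a b') = 0 := by
    intro a b' ha hab hb
    obtain ⟨η, hη, hηA, hηB⟩ : ∃ η : ℝ, 0 < η ∧ A < a - η ∧ b' + η < B :=
      ⟨min (a - A) (B - b') / 2, by
        have := lt_min (sub_pos.2 ha) (sub_pos.2 hb); positivity, by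
        have := min_le_left (a - A) (B - b'); linarith [lt_min (sub_pos.2 ha) (sub_pos.2 hb)], by
        have := min_le_right (a - A) (B - b'); linarith [lt_min (sub_pos.2 ha) (sub_pos.2 hb)]⟩
    obtain ⟨g, hgc, hgs, hg01, hg1, hgsupp⟩ := exists_trapezoid a b' hη
    have hlim := tendsto_integral_mul_im h hgc hgs
    -- the integrals are eventually small
    have hsmall : ∀ ε > 0, ∀ᶠ y : ℝ in 𝓝[>] 0,
        |∫ x, g x * (q ((x : ℂ) + (y : ℂ) * Complex.I)).im| ≤ ε * (b' + η - (a - η)) := by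
      intro ε hε
      filter_upwards [hunif ε hε] with y hy
      rw [← Real.norm_eq_abs]
      have hvol : volume (Icc (a - η) (b' + η)) < ⊤ := measure_Icc_lt_top
      rw [← setIntegral_eq_integral_of_forall_compl_eq_zero (s := Icc (a - η) (b' + η))
        (fun x hx => by rw [show g x = 0 from not_not.1 (fun h0 => hx (hgsupp x h0)), zero_mul])]
      calc ‖∫ x in Icc (a - η) (b' + η), g x * (q ((x : ℂ) + y * Complex.I)).im‖
          ≤ ε * volume.real (Icc (a - η) (b' + η)) := by
            refine norm_setIntegral_le_of_norm_le_const hvol (fun x hx => ?_)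
            rw [norm_mul, Real.norm_eq_abs, Real.norm_eq_abs, abs_of_nonneg (hg01 x).1]
            calc g x * |(q ((x : ℂ) + y * Complex.I)).im| ≤ 1 * ε :=
                  mul_le_mul (hg01 x).2 (hy x ⟨by linarith [hx.1], by linarith [hx.2]⟩)
                    (abs_nonneg _) zero_le_one
              _ = ε := one_mul ε
        _ = ε * (b' + η - (a - η)) := by rw [Real.volume_real_Icc_of_le (by linarith)]
    -- hence `|π ∫ g dσ| ≤ ε L` for every `ε`, so `∫ g dσ = 0`
    set L := b' + η - (a - η) with hL'
    have hL : 0 < L := by rw [hL']; linarith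
    have habs : ∀ ε > 0, |Real.pi * ∫ t, g t ∂σ| ≤ ε * L := fun ε hε =>
      le_of_tendsto ((continuous_abs.tendsto _).comp hlim) (hsmall ε hε)
    have hint0 : ∫ t, g t ∂σ = 0 := by
      have h0 : |Real.pi * ∫ t, g t ∂σ| ≤ 0 := by
        refine le_of_forall_pos_le_add (fun ε hε => ?_)
        have := habs (ε / L) (by positivity)
        rw [div_mul_cancel₀ _ hL.ne'] at this
        linarith
      have h1 : Real.pi * ∫ t, g t ∂σ = 0 := abs_nonpos_iff.1 h0
      exact (mul_eq_zero.1 h1).resolve_left Real.pi_pos.ne'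
    -- and `σ [a, b'] ≤ ∫ g dσ`
    have hgi : Integrable g σ := hgc.integrable_of_hasCompactSupport hgs
    have hfin : σ (Icc a b') < ⊤ := measure_Icc_lt_top
    have hle : (σ (Icc a b')).toReal ≤ ∫ t, g t ∂σ := by
      have hind : (σ (Icc a b')).toReal = ∫ t, (Icc a b').indicator (fun _ => (1 : ℝ)) t ∂σ := by
        rw [integral_indicator measurableSet_Icc, setIntegral_const, smul_eq_mul, mul_one,
          measureReal_def]
      rw [hind]
      refine integral_mono ?_ hgi (fun t => ?_)
      · exact (integrable_indicator_iff measurableSet_Icc).2 (integrableOn_const hfin.ne)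
      · by_cases ht : t ∈ Icc a b'
        · rw [indicator_of_mem ht, hg1 t ht]
        · rw [indicator_of_notMem ht]; exact (hg01 t).1
    rw [hint0] at hle
    have : (σ (Icc a b')).toReal = 0 := le_antisymm hle ENNReal.toReal_nonneg
    exact (ENNReal.toReal_eq_zero_iff _).1 this |>.resolve_right hfin.ne
  -- exhaust `(A, B)` by closed subintervals
  rcases le_or_gt B A with hBA | hAB
  · rw [Ioo_eq_empty (not_lt.2 hBA), measure_empty]
  have hunion : Ioo A B = ⋃ n : ℕ, Icc (A + (B - A) / (n + 2)) (B - (B - A) / (n + 2)) := by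
    ext x
    simp only [mem_Ioo, mem_iUnion, mem_Icc]
    constructor
    · rintro ⟨h1, h2⟩
      obtain ⟨n, hn⟩ := exists_nat_gt ((B - A) / min (x - A) (B - x))
      have hm : 0 < min (x - A) (B - x) := lt_min (by linarith) (by linarith)
      refine ⟨n, ?_, ?_⟩
      · have : (B - A) / (n + 2) ≤ x - A := by
          rw [div_le_iff₀ (by positivity)]
          rw [div_lt_iff₀ hm] at hn
          nlinarith [min_le_left (x - A) (B - x)]
        linarith
      · have : (B - A) / (n + 2) ≤ B - x := by
          rw [div_le_iff₀ (by positivity)]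
          rw [div_lt_iff₀ hm] at hn
          nlinarith [min_le_right (x - A) (B - x)]
        linarith
    · rintro ⟨n, h1, h2⟩
      have : 0 < (B - A) / (n + 2) := by positivity
      exact ⟨by linarith, by linarith⟩
  rw [hunion]
  refine measure_iUnion_null (fun n => hIcc _ _ ?_ ?_ ?_)
  · have : 0 < (B - A) / (n + 2) := by positivity
    linarith
  · have : (B - A) / (n + 2) ≤ (B - A) / 2 := by
      rw [div_le_div_iff₀ (by positivity) (by positivity)]
      nlinarith
    linarith
  · have : 0 < (B - A) / (n + 2) := by positivity
    linarith

end Inversion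

end Literature.Analysis.InverseSpectral

end
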